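import Literature.MathematicalPhysics.QuantumLattice.KomaPiFluxThermalSpontaneousOrder
import Literature.MathematicalPhysics.QuantumLattice.KomaPiFluxInfiniteVolumeOrder
import Literature.MathematicalPhysics.QuantumLattice.GibbsTwoTimeBound
import Literature.MathematicalPhysics.QuantumLattice.TorusLimitOfMixturesCompactness
import HarnessLib

/-!
# Spontaneous superconducting order at positive temperature IN INFINITE VOLUME for Koma's `π`-flux BCS
# model: the thermodynamic-limit Gibbs states under a field `B > 0`, and their `B ↘ 0` limits, carry
# `|Λ|⁻¹ ω(O^{(Λ)}) ≥ 3/100` on EVERY finite box — the `T > 0` twin of Koma 2022 eq. (2.15)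

T. Koma, arXiv:2201.13135 (2022) [Koma2022]: (2.10) the thermal expectation `⟨⋯⟩^{(Λ)}_{β,B}` of
`H^{(Λ)}(B) = H_hop + H_int - B O^{(Λ)}`; Theorem 2.1 (thermal long-range order, `d+1 ≥ 3`, `β ≥ β_c`); (2.13)–(2.15)
the zero-temperature symmetry-breaking state `ω_{0,g'} = w*-lim_{B↘0} w*-lim_{Λ↗ℤ^d} lim_{β↗∞}⟨⋯⟩_{β,B}` with
`|Λ|⁻¹ω_{0,g'}(O^{(Λ)}) ≥ μ > 0` — in the tree `KomaPiFluxInfiniteVolumeOrder.lean`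
(`IsInfinitesimalFieldGroundState.boxOrder_ge_coulomb`).  T. Koma, H. Tasaki, Commun. Math. Phys. 158 (1993) 191
[KomaTasaki1993], (2.11): the spontaneous magnetisation `m_s = lim_{B↓0} lim_{Λ↑ℤ^d} N⁻¹⟨O_Λ⟩_Λ(B)` at inverse
temperature `β`, and Theorem 2.1 / Corollary 2.2 (`U(1)`: Remark after Theorem 6.1), `m_s ≥ √2 σ`.

`KomaPiFluxThermalSpontaneousOrder.lean` proved the FINITE-VOLUME positive-temperature statement
(`KomaPiFlux.thermal_spontaneousOrder_coulomb_sharp`: `β ≥ β₀`, every `B > 0` ⟹ eventually on the even tori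
`|Λ|⁻¹ Re⟨Σ_xΓ²_x⟩_{β,B} ≥ 3/100`).  This file passes to the INFINITE-VOLUME STATES of the CAR algebra over
`ℤ^D × {↑,↓}` (`InfVolFermionState (d+1)`), in the order of limits of KT93 (2.11) / Koma (2.14) — volume first,
field second — exactly parallel to the zero-temperature file:

* §1 (general, PROVED) **`Matrix.IsHermitian.exists_gibbsState_eq_mixture`**: the Gibbs state of a Hermitian
  matrix is a finite probability mixture of unit vectors, `⟨O⟩_β = Σ_i p_i ⟨e_i, O e_i⟩` for ALL `O`
  (eigenbasis, Boltzmann weights `p_i = e^{-βE_i}/Z`).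
* §2 `KomaPiFlux.torusAvgGibbsExpectAt L β H Λ A` — the translation-averaged Gibbs expectation
  `|Λ_L|⁻¹ Σ_v ⟨U_v⋆ Γ(A) U_v⟩_{β,H}` of a local observable `A ∈ 𝔄_Λ` on the torus of side `L` (junk `0` if `Λ`
  does not fit); it is a probability mixture of the tree's vector averages `torusAvgExpect`, uniformly in `(Λ, A)`
  (`exists_torusAvgGibbsExpectAt_eq_mixture`), and on the local order density it is the order parameter per
  site: **`torusAvgGibbsExpectAt_localGammaTwo`**: `= |Λ|⁻¹⟨Σ_yΓ²_y⟩_{β,H}`.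
* §3 `KomaPiFlux.IsSourcedThermalLimit κ U g g' β B ω` — `ω` is a thermodynamic limit, along even tori
  `(ℤ/2k_jℤ)^D`, `k_j → ∞`, of translation-averaged finite probability mixtures of unit vectors REALISING the Gibbs
  states `⟨⋯⟩_{β,B}` of `H_C(B) = hamiltonianC κ U g g' 0 B` (i.e. of the translation-averaged Gibbs states;
  `IsSourcedThermalLimit.of_tendsto`); `KomaPiFlux.IsInfinitesimalFieldThermalState κ U g g' β ω` — a weak-⋆
  limit of such as `B_n ↘ 0` (KT93's `m_s` order of limits).  ENGINE **`IsSourcedThermalLimit.le_re_expect_localGammaTwo`**: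
  a finite-volume floor "for every `ε > 0`, eventually in `k`, `μ - ε ≤ |Λ|⁻¹ Re⟨Σ_xΓ²_x⟩_{β,B}`" gives
  `μ ≤ Re ω(Γ²_x)` at EVERY site `x ∈ ℤ^D`; it passes to the infinitesimal-field states and sums to
  `μ·|Λ| ≤ Re ω(O^{(Λ)})` on every finite region (`boxOrder_ge_of_forall_site` of the `T = 0` file).
* §4 KOMA'S MODEL: **`IsInfinitesimalFieldThermalState.boxOrder_ge_coulomb`** — `D = d+1 ≥ 3`, `g > 0`,
  `|κ| ≤ g/1000`, `0 ≤ g' ≤ g/2000`, `U + 2gD ≤ 0`: there is `β₀ > 0` such that for every `β ≥ β₀`, every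
  infinitesimal-field thermal state `ω` at `β` has **`(3/100)·|Λ| ≤ Re ω(O^{(Λ)})` for EVERY finite `Λ ⊂ ℤ^D`** (and
  every sourced thermal limit at any `B > 0` as well): spontaneous superconducting order at positive temperature in
  the infinite system; NON-VACUITY (`exists_isSourcedThermalLimit`, `exists_isInfinitesimalFieldThermalState`, by
  the tree's weak-⋆ compactness `InfVolFermionState.exists_isTorusLimitOfMixture_subseq` /
  `exists_tendsto_expect_subseq`); structural facts (sourced thermal limits are translation invariant).

Faithfulness / what is NOT claimed.  The limit states are not asserted to be KMS states of an infinite-volume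
dynamics (not needed for the order-parameter statement, and not printed by Koma for `T > 0`); the combination
"Koma Thm 2.1 + KT93 Thm 2.1/Cor 2.2 (hypothesis i) removed)" is a corollary of the printed theorems, stated by
neither paper in this form.  Torus states are translation-AVERAGED before the limit (the tree's convention,
Bratteli–Robinson I §4.3.1), which is what makes the box bound hold on every box.  Sibling-model statement, NOT
a statement about the Hubbard model.  Definitions with bodies: `torusAvgGibbsExpectAt`, `IsSourcedThermalLimit`,
`IsInfinitesimalFieldThermalState`; everything else PROVED; no named fact.

## References

* [Koma2022] T. Koma, arXiv:2201.13135, §2 (2.4)–(2.6), (2.10)–(2.15), Theorem 2.1.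
* [KomaTasaki1993] T. Koma, H. Tasaki, Commun. Math. Phys. 158 (1993) 191–214, §2 (2.9)–(2.13), Theorem 2.1,
  Corollary 2.2, Remark after Theorem 6.1; p. 196.
* [BratteliRobinsonI1987] O. Bratteli, D. W. Robinson, *OAQSM 1*, 2nd ed., §4.3.1, Thm. 2.3.15.
* [BratteliRobinsonII1997] O. Bratteli, D. W. Robinson, *OAQSM 2*, 2nd ed., §5.3.1 (Gibbs states of matrix
  algebras), (5.3.2).
* [Tasaki2020] H. Tasaki, *Physics and Mathematics of Quantum Many-Body Systems*, Springer 2020, App. A.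
-/

noncomputable section

namespace Literature.MathematicalPhysics.QuantumLattice

open _root_.Matrix Finset Filter Topology HubbardWave0 PairHopRP FermionTorus LiebCutRP
open Literature.Probability.LatticeModels
open scoped Matrix.Norms.L2Operator ComplexConjugate ComplexOrder

/-! ### §1. A Gibbs state is a finite probability mixture of unit vectors -/

section General

variable {n : Type*} [Fintype n] [DecidableEq n]

omit [DecidableEq n] in
/-- A diagonal entry of `Vᴴ O V` is the expectation of `O` in the corresponding column of `V`. [folklore] -/
private theorem conjTranspose_mul_mul_apply_same (V O : Matrix n n ℂ) (a : n) :
    (Vᴴ * O * V) a a = star (fun i => V i a) ⬝ᵥ (O *ᵥ fun i => V i a) := by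
  rw [Matrix.mul_assoc, Matrix.mul_apply]
  simp only [conjTranspose_apply, dotProduct, Pi.star_apply, mulVec, Matrix.mul_apply]

/-- **The Gibbs state of a Hermitian matrix is a finite probability mixture of unit vectors**: there are
weights `p_i ≥ 0`, `Σ_i p_i = 1`, and unit vectors `e_i` (an orthonormal eigenbasis, Boltzmann weights
`e^{-βE_i}/Z`) with `⟨O⟩_{β,H} = Σ_i p_i ⟨e_i, O e_i⟩` for EVERY matrix `O`.
[cite: BratteliRobinsonII1997, §5.3.1 (5.3.2)] [cite: Tasaki2020, App. A] -/
theorem _root_.Matrix.IsHermitian.exists_gibbsState_eq_mixture [Nonempty n] {H : Matrix n n ℂ}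
    (hH : H.IsHermitian) (β : ℝ) :
    ∃ (m : ℕ) (p : Fin m → ℝ) (e : Fin m → n → ℂ), (∀ i, 0 ≤ p i) ∧ ∑ i, p i = 1 ∧
      (∀ i, star (e i) ⬝ᵥ e i = 1) ∧
      ∀ O : Matrix n n ℂ, gibbsState β H O = ∑ i, (p i : ℂ) * (star (e i) ⬝ᵥ (O *ᵥ e i)) := by
  classical
  let U : Matrix n n ℂ := (hH.eigenvectorUnitary : Matrix n n ℂ)
  let w : n → ℝ := fun a => Real.exp (-β * hH.eigenvalues a)
  have hw0 : ∀ a, 0 < w a := fun a => Real.exp_pos _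
  have hZ0 : 0 < ∑ a, w a := Finset.sum_pos (fun a _ => hw0 a) Finset.univ_nonempty
  let eqv := Fintype.equivFin n
  have hstar : (star hH.eigenvectorUnitary : Matrix n n ℂ) = Uᴴ := Matrix.star_eq_conjTranspose _
  have hUU : Uᴴ * U = 1 := by
    have h := Unitary.coe_star_mul_self hH.eigenvectorUnitary
    rwa [hstar] at h
  refine ⟨Fintype.card n, fun i => w (eqv.symm i) / ∑ a, w a, fun i => fun k => U k (eqv.symm i),
    fun i => (div_pos (hw0 _) hZ0).le, ?_, fun i => ?_, fun O => ?_⟩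
  · rw [← Finset.sum_div, eqv.symm.sum_comp (fun a => w a), div_self hZ0.ne']
  · have h2 := congrFun (congrFun hUU (eqv.symm i)) (eqv.symm i)
    rw [Matrix.one_apply_eq, Matrix.mul_apply] at h2
    rw [← h2]
    simp only [conjTranspose_apply, dotProduct, Pi.star_apply]
  · rw [gibbsState_apply, partitionFn_eq_sum_exp β hH, trace_gibbsWeight_mul_eq_sum hH β O, hstar,
      ← eqv.symm.sum_comp (fun a => (Real.exp (-β * hH.eigenvalues a) : ℂ) * (Uᴴ * O * U) a a), Finset.mul_sum]
    refine Finset.sum_congr rfl fun i _ => ?_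
    rw [conjTranspose_mul_mul_apply_same]
    have hZc : (∑ a, (Real.exp (-β * hH.eigenvalues a) : ℂ)) = ((∑ a, w a : ℝ) : ℂ) := by
      rw [Complex.ofReal_sum]
    rw [hZc, Complex.ofReal_div, div_eq_mul_inv]
    ring

end General

namespace KomaPiFlux

attribute [local instance] LiebCutRP.decEqTorus

variable {d : ℕ}

open KT

/-! ### §2. Translation-averaged Gibbs expectations of local observables on the torus -/

/-- **The translation-averaged Gibbs expectation** of a local observable `A ∈ 𝔄_Λ` on the torus of side `L`
at inverse temperature `β` for the Hamiltonian `H`: `|Λ_L|⁻¹ Σ_v ⟨U_v⋆ Γ(A) U_v⟩_{β,H}`; junk value `0` when `Λ` does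
not fit into the torus (as for `torusAvgExpectAt`). [cite: Koma2022, (2.10)] [cite: BratteliRobinsonI1987, §4.3.1] -/
def torusAvgGibbsExpectAt (L : ℕ) [NeZero L] (β : ℝ) (H : Matrix (Idx d L) (Idx d L) ℂ)
    (Λ : Finset (Site (d + 1))) (A : FermionOp Λ) : ℂ :=
  if h : Set.InjOn (Torus.proj (d := d + 1) L) ↑Λ then
    ((Fintype.card (TorusSite (d + 1) L) : ℂ))⁻¹ *
      ∑ v : TorusSite (d + 1) L, gibbsState β H (relabel (Orb.translate v).symm (fermionEmbed (PolySite.toTorusEmb L h) A))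
  else 0

/-- **The translation-averaged Gibbs state is a finite probability mixture of translation-averaged vector
states**, uniformly in the observable: for Hermitian `H` there are weights `p_i ≥ 0`, `Σ p_i = 1` and unit vectors
`ψ_i` realising the Gibbs state (`⟨O⟩_{β,H} = Σ_i p_i ⟨ψ_i, Oψ_i⟩` for all `O`) with
`torusAvgGibbsExpectAt L β H Λ A = Σ_i p_i · torusAvgExpect L Λ A ψ_i` for ALL regions `Λ` and ALL `A ∈ 𝔄_Λ`.
[cite: BratteliRobinsonII1997, §5.3.1 (5.3.2)] [cite: BratteliRobinsonI1987, §4.3.1] -/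
theorem exists_torusAvgGibbsExpectAt_eq_mixture (L : ℕ) [NeZero L] (β : ℝ) {H : Matrix (Idx d L) (Idx d L) ℂ}
    (hH : H.IsHermitian) :
    ∃ (m : ℕ) (p : Fin m → ℝ) (ψ : Fin m → Fock (Orb (FermionTorus (d + 1) L))), (∀ i, 0 ≤ p i) ∧ ∑ i, p i = 1 ∧
      (∀ i, star (ψ i) ⬝ᵥ ψ i = 1) ∧
      (∀ O : Matrix (Idx d L) (Idx d L) ℂ, gibbsState β H O = ∑ i, (p i : ℂ) * expect O (ψ i)) ∧
      ∀ (Λ : Finset (Site (d + 1))) (A : FermionOp Λ),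
        torusAvgGibbsExpectAt L β H Λ A = ∑ i, (p i : ℂ) * torusAvgExpect L Λ A (ψ i) := by
  obtain ⟨m, p, e, hp0, hp1, he, havg⟩ := hH.exists_gibbsState_eq_mixture β
  refine ⟨m, p, e, hp0, hp1, he, fun O => havg O, fun Λ A => ?_⟩
  by_cases h : Set.InjOn (Torus.proj (d := d + 1) L) ↑Λ
  · rw [torusAvgGibbsExpectAt, dif_pos h]
    simp_rw [torusAvgExpect_eq, torusAvgExpectAt_of_injOn L h, havg, expect_fockRelabel_mulVec, Finset.mul_sum]
    rw [Finset.sum_comm]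
    refine Finset.sum_congr rfl fun i _ => Finset.sum_congr rfl fun v _ => ?_
    rw [expect]
    ring
  · rw [torusAvgGibbsExpectAt, dif_neg h]
    simp_rw [torusAvgExpect_eq, torusAvgExpectAt_of_not_injOn L h, mul_zero, Finset.sum_const_zero]

/-- **The translation-averaged Gibbs expectation of the local order density is the order parameter per
site**: `torusAvgGibbsExpectAt L β H {x} Γ²_x = |Λ|⁻¹ ⟨Σ_yΓ²_y⟩_{β,H}` (Hermitian `H`).
[cite: Koma2022, (2.5), (2.10)] [cite: KomaTasaki1993, (2.9), (2.11)] -/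
theorem torusAvgGibbsExpectAt_localGammaTwo (L : ℕ) [NeZero L] (β : ℝ) {H : Matrix (Idx d L) (Idx d L) ℂ}
    (hH : H.IsHermitian) (x : Site (d + 1)) :
    torusAvgGibbsExpectAt L β H {x} (localGammaTwo x) =
      ((Fintype.card (FermionTorus (d + 1) L) : ℂ))⁻¹ * gibbsState β H orderParameter := by
  obtain ⟨m, p, ψ, -, -, -, hO, havg⟩ := exists_torusAvgGibbsExpectAt_eq_mixture L β hH
  rw [havg, hO, Finset.mul_sum]
  refine Finset.sum_congr rfl fun i _ => ?_
  rw [torusAvgExpect_localGammaTwo]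
  ring

/-- The real part: `Re torusAvgGibbsExpectAt L β H {x} Γ²_x = |Λ|⁻¹ Re⟨Σ_yΓ²_y⟩_{β,H}` — the KT93 magnetisation per
site `m_Λ(B)` of `KomaPiFlux.z2System` when `H = H_C(B)`. [cite: KomaTasaki1993, (2.9), (2.11)] -/
theorem re_torusAvgGibbsExpectAt_localGammaTwo (L : ℕ) [NeZero L] (β : ℝ) {H : Matrix (Idx d L) (Idx d L) ℂ}
    (hH : H.IsHermitian) (x : Site (d + 1)) :
    (torusAvgGibbsExpectAt L β H {x} (localGammaTwo x)).re =
      (Fintype.card (FermionTorus (d + 1) L) : ℝ)⁻¹ * (gibbsState β H orderParameter).re := by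
  rw [torusAvgGibbsExpectAt_localGammaTwo L β hH, ← Complex.ofReal_natCast, ← Complex.ofReal_inv,
    Complex.re_ofReal_mul]

/-! ### §3. Sourced thermal limits, infinitesimal-field thermal states, and the engine -/

/-- **A sourced thermal limit at `(β, B)`**: an infinite-volume state `ω` for which there are even tori
`(ℤ/2k_jℤ)^{d+1}`, `k_j → ∞`, and on each a finite probability mixture of unit vectors REALISING the Gibbs state
`⟨⋯⟩_{β,B}` of `H_C(B) = hamiltonianC κ U g g' 0 B` (`⟨O⟩_{β,B} = Σ_i p_i⟨ψ_i, Oψ_i⟩` for all `O`; such mixtures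
exist, `exists_torusAvgGibbsExpectAt_eq_mixture`), such that `ω` is the thermodynamic limit of the
translation-averaged mixtures (`IsTorusLimitOfMixture`) — i.e. of the translation-averaged Gibbs states
(`IsSourcedThermalLimit.of_tendsto`). [cite: KomaTasaki1993, (2.9)–(2.11)] [cite: Koma2022, (2.10), (2.14)]
[cite: BratteliRobinsonI1987, §4.3.1] -/
def IsSourcedThermalLimit (κ U g g' β B : ℝ) (ω : InfVolFermionState (d + 1)) : Prop :=
  ∃ (k : ℕ → ℕ) (m : ℕ → ℕ) (p : ∀ L, Fin (m L) → ℝ)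
    (ψ : ∀ L, Fin (m L) → Fock (Orb (FermionTorus (d + 1) L))),
    Tendsto k atTop atTop ∧ (∀ L i, 0 ≤ p L i) ∧ (∀ j, ∑ i, p (2 * k j) i = 1) ∧
    (∀ j i, star (ψ (2 * k j) i) ⬝ᵥ ψ (2 * k j) i = 1) ∧
    (∀ j, ∀ [NeZero (2 * k j)], ∀ O : Matrix (Idx d (2 * k j)) (Idx d (2 * k j)) ℂ,
      gibbsState β (hamiltonianC κ U g g' (fun (_ _ : FermionTorus (d + 1) (2 * k j)) => (0 : ℝ)) B) O =
        ∑ i, (p (2 * k j) i : ℂ) * expect O (ψ (2 * k j) i)) ∧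
    ω.IsTorusLimitOfMixture m p ψ (fun j => 2 * k j)

/-- **An infinitesimal-field thermal state at `β`** (KT93's order of limits for `m_s`, (2.11); the `T > 0` twin
of Koma's `ω_{0,g'}` (2.14)): a weak-⋆ limit (pointwise on every local algebra `𝔄_Λ`) of sourced thermal limits
`ω_n` at `(β, B_n)` with `B_n > 0`, `B_n → 0`. [cite: KomaTasaki1993, (2.11)] [cite: Koma2022, (2.14)] -/
def IsInfinitesimalFieldThermalState (κ U g g' β : ℝ) (ω : InfVolFermionState (d + 1)) : Prop :=
  ∃ (B : ℕ → ℝ) (ωB : ℕ → InfVolFermionState (d + 1)),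
    (∀ n, 0 < B n) ∧ Tendsto B atTop (𝓝 0) ∧ (∀ n, IsSourcedThermalLimit κ U g g' β (B n) (ωB n)) ∧
    ∀ (Λ : Finset (Site (d + 1))) (A : FermionOp Λ), Tendsto (fun n => (ωB n).expect Λ A) atTop (𝓝 (ω.expect Λ A))

/-- Sourced thermal limits are translation invariant. [cite: BratteliRobinsonI1987, §4.3.1] -/
theorem IsSourcedThermalLimit.isTranslationInvariant {κ U g g' β B : ℝ} {ω : InfVolFermionState (d + 1)}
    (h : IsSourcedThermalLimit κ U g g' β B ω) : ω.IsTranslationInvariant := by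
  obtain ⟨_, _, _, _, -, -, -, -, -, hω⟩ := h
  exact hω.isTranslationInvariant

/-- **The translation-averaged Gibbs expectations converge along a sourced thermal limit**: for every region
`Λ` and `A ∈ 𝔄_Λ`, `torusAvgGibbsExpectAt (2k_j) β H_C(B) Λ A → ω_Λ(A)`. [cite: BratteliRobinsonI1987, §4.3.1] -/
theorem IsSourcedThermalLimit.tendsto_torusAvgGibbsExpectAt {κ U g g' β B : ℝ} {ω : InfVolFermionState (d + 1)}
    (h : IsSourcedThermalLimit κ U g g' β B ω) :
    ∃ k : ℕ → ℕ, Tendsto k atTop atTop ∧ ∀ (Λ : Finset (Site (d + 1))) (A : FermionOp Λ),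
      Tendsto (fun j => if hk : k j = 0 then (0 : ℂ) else
        haveI : NeZero (2 * k j) := ⟨by omega⟩
        torusAvgGibbsExpectAt (2 * k j) β
          (hamiltonianC κ U g g' (fun (_ _ : FermionTorus (d + 1) (2 * k j)) => (0 : ℝ)) B) Λ A)
        atTop (𝓝 (ω.expect Λ A)) := by
  obtain ⟨k, m, p, ψ, hk, hp0, hp1, hψ, hG, hω⟩ := h
  refine ⟨k, hk, fun Λ A => ?_⟩
  refine (hω Λ A).congr' ?_
  filter_upwards [hk.eventually_ge_atTop 1] with j hj
  have hkj : k j ≠ 0 := by omega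
  rw [dif_neg hkj]
  haveI : NeZero (2 * k j) := ⟨by omega⟩
  have hH := hamiltonianC_isHermitian κ U g g' (fun (_ _ : FermionTorus (d + 1) (2 * k j)) => (0 : ℝ)) B
  obtain ⟨m', p', e', -, -, -, hO', havg'⟩ := exists_torusAvgGibbsExpectAt_eq_mixture (2 * k j) β hH
  -- both mixtures realise the same Gibbs state, hence the same translation averages
  rw [havg']
  by_cases hfit : Set.InjOn (Torus.proj (d := d + 1) (2 * k j)) ↑Λ
  · simp_rw [torusAvgExpect_eq, torusAvgExpectAt_of_injOn _ hfit, expect_fockRelabel_mulVec, Finset.mul_sum]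
    rw [Finset.sum_comm]
    conv_rhs => rw [Finset.sum_comm]
    refine Finset.sum_congr rfl fun v _ => ?_
    have h1 := hO' (relabel (Orb.translate v).symm (fermionEmbed (PolySite.toTorusEmb (2 * k j) hfit) A))
    have h2 := hG j (relabel (Orb.translate v).symm (fermionEmbed (PolySite.toTorusEmb (2 * k j) hfit) A))
    simp_rw [← mul_assoc, mul_comm _ (((Fintype.card (TorusSite (d + 1) (2 * k j)) : ℂ))⁻¹), mul_assoc,
      ← Finset.mul_sum]
    rw [← h2, ← h1]
  · simp_rw [torusAvgExpect_eq, torusAvgExpectAt_of_not_injOn _ hfit, mul_zero, Finset.sum_const_zero]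

/-- **Sourced thermal limits from convergent translation-averaged Gibbs states.**  If along even tori of side
`2k_j`, `k_j ≥ 1`, `k_j → ∞`, the translation-averaged Gibbs expectations of every local observable converge to
`ω`, then `ω` is a sourced thermal limit (each Gibbs state is realised by a probability mixture of unit vectors,
`exists_torusAvgGibbsExpectAt_eq_mixture`). [cite: KomaTasaki1993, (2.9)–(2.11)] [cite: BratteliRobinsonI1987, §4.3.1] -/
theorem IsSourcedThermalLimit.of_tendsto {κ U g g' β B : ℝ} {k : ℕ → ℕ} (hk : Tendsto k atTop atTop)
    (hk1 : ∀ j, 0 < k j) {ω : InfVolFermionState (d + 1)}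
    (hω : ∀ (Λ : Finset (Site (d + 1))) (A : FermionOp Λ),
      Tendsto (fun j =>
        haveI : NeZero (2 * k j) := ⟨by have := hk1 j; omega⟩
        torusAvgGibbsExpectAt (2 * k j) β
          (hamiltonianC κ U g g' (fun (_ _ : FermionTorus (d + 1) (2 * k j)) => (0 : ℝ)) B) Λ A)
        atTop (𝓝 (ω.expect Λ A))) :
    IsSourcedThermalLimit κ U g g' β B ω := by
  classical
  -- a realising mixture on every torus of side `L ≠ 0` (junk at `L = 0`)
  have hmix : ∀ L : ℕ, ∃ (m : ℕ) (p : Fin m → ℝ) (ψ : Fin m → Fock (Orb (FermionTorus (d + 1) L))),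
      (∀ i, 0 ≤ p i) ∧ ∀ [NeZero L], ∑ i, p i = 1 ∧ (∀ i, star (ψ i) ⬝ᵥ ψ i = 1) ∧
        (∀ O : Matrix (Idx d L) (Idx d L) ℂ,
          gibbsState β (hamiltonianC κ U g g' (fun (_ _ : FermionTorus (d + 1) L) => (0 : ℝ)) B) O =
            ∑ i, (p i : ℂ) * expect O (ψ i)) ∧
        ∀ (Λ : Finset (Site (d + 1))) (A : FermionOp Λ),
          torusAvgGibbsExpectAt L β (hamiltonianC κ U g g' (fun (_ _ : FermionTorus (d + 1) L) => (0 : ℝ)) B) Λ A =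
            ∑ i, (p i : ℂ) * torusAvgExpect L Λ A (ψ i) := by
    intro L
    by_cases hL : L = 0
    · exact ⟨0, fun i => i.elim0, fun i => i.elim0, fun i => i.elim0, absurd hL (NeZero.ne L)⟩
    · haveI : NeZero L := ⟨hL⟩
      obtain ⟨m, p, ψ, hp0, hp1, hψ, hO, havg⟩ := exists_torusAvgGibbsExpectAt_eq_mixture L β
        (hamiltonianC_isHermitian κ U g g' (fun (_ _ : FermionTorus (d + 1) L) => (0 : ℝ)) B)
      exact ⟨m, p, ψ, hp0, ⟨hp1, hψ, hO, havg⟩⟩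
  choose m p ψ hp0 hrest using hmix
  have hne : ∀ j, NeZero (2 * k j) := fun j => ⟨by have := hk1 j; omega⟩
  refine ⟨k, m, p, ψ, hk, hp0, fun j => (@hrest (2 * k j) (hne j)).1, fun j i => (@hrest (2 * k j) (hne j)).2.1 i,
    fun j _ O => (@hrest (2 * k j) (hne j)).2.2.1 O, fun Λ A => ?_⟩
  refine (hω Λ A).congr (fun j => ?_)
  exact (@hrest (2 * k j) (hne j)).2.2.2 Λ A

/-- A weighted average with probability weights of numbers `≥ c` is `≥ c`. [folklore] -/
private theorem le_sum_mul_of_forall_le' {m : ℕ} {p : Fin m → ℝ} (hp0 : ∀ i, 0 ≤ p i) (hp1 : ∑ i, p i = 1)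
    {f : Fin m → ℝ} {c : ℝ} (hf : ∀ i, c ≤ f i) : c ≤ ∑ i, p i * f i := by
  calc c = ∑ i, p i * c := by rw [← Finset.sum_mul, hp1, one_mul]
    _ ≤ ∑ i, p i * f i := Finset.sum_le_sum fun i _ => mul_le_mul_of_nonneg_left (hf i) (hp0 i)

/-- **ENGINE, infinite volume, `T > 0`.**  If for every `ε > 0` the sourced order parameter per site obeys
`μ - ε ≤ |Λ|⁻¹ Re⟨Σ_xΓ²_x⟩_{β, H_C(B)}` on all large even tori (the conclusion of
`thermal_orderParameter_ge_of_lroSq(_sqrtTwo)`), then every sourced thermal limit `ω` at `(β, B)` has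
`μ ≤ Re ω(Γ²_x)` at EVERY site `x ∈ ℤ^D` (the translation-averaged Gibbs expectation of `Γ²_x` IS the order parameter
per site, `torusAvgGibbsExpectAt_localGammaTwo`; a closed condition in the limit).
[cite: KomaTasaki1993, (2.11), Theorem 2.1] [cite: Koma2022, (2.10), (2.15)] -/
theorem IsSourcedThermalLimit.le_re_expect_localGammaTwo {κ U g g' β B μ : ℝ}
    (hfloor : ∀ ε : ℝ, 0 < ε → ∃ k₁ : ℕ, ∀ k : ℕ, k₁ ≤ k → ∀ [NeZero (2 * k)],
      μ - ε ≤ (Fintype.card (FermionTorus (d + 1) (2 * k)) : ℝ)⁻¹ *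
        (gibbsState β (hamiltonianC κ U g g' (fun (_ _ : FermionTorus (d + 1) (2 * k)) => (0 : ℝ)) B)
          orderParameter).re)
    {ω : InfVolFermionState (d + 1)} (hω : IsSourcedThermalLimit κ U g g' β B ω) (x : Site (d + 1)) :
    μ ≤ (ω.expect {x} (localGammaTwo x)).re := by
  obtain ⟨k, m, p, ψ, hk, hp0, hp1, hψ, hG, hlim⟩ := hω
  have hre : Tendsto (fun j => (∑ i, (p (2 * k j) i : ℂ) * torusAvgExpect (2 * k j) {x} (localGammaTwo x)
      (ψ (2 * k j) i)).re) atTop (𝓝 (ω.expect {x} (localGammaTwo x)).re) :=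
    (Complex.continuous_re.tendsto _).comp (hlim {x} (localGammaTwo x))
  refine le_of_forall_pos_le_add fun ε hε => ?_
  obtain ⟨k₁, hk₁⟩ := hfloor ε hε
  have hev : ∀ᶠ j in atTop, μ - ε ≤ (∑ i, (p (2 * k j) i : ℂ) *
      torusAvgExpect (2 * k j) {x} (localGammaTwo x) (ψ (2 * k j) i)).re := by
    filter_upwards [hk.eventually_ge_atTop (max k₁ 1)] with j hj
    haveI : NeZero (2 * k j) := ⟨by omega⟩
    have hterm : ∀ i, ((p (2 * k j) i : ℂ) * torusAvgExpect (2 * k j) {x} (localGammaTwo x) (ψ (2 * k j) i)) =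
        ((Fintype.card (FermionTorus (d + 1) (2 * k j)) : ℂ))⁻¹ *
          ((p (2 * k j) i : ℂ) * expect orderParameter (ψ (2 * k j) i)) := by
      intro i
      rw [torusAvgExpect_localGammaTwo]
      ring
    simp_rw [hterm]
    rw [← Finset.mul_sum, ← hG j orderParameter, ← Complex.ofReal_natCast, ← Complex.ofReal_inv,
      Complex.re_ofReal_mul]
    exact hk₁ (k j) (le_trans (le_max_left _ _) hj)
  have := ge_of_tendsto hre hev
  linarith

/-- The site bound passes to the infinitesimal-field thermal states. [cite: KomaTasaki1993, (2.11)] [cite: Koma2022, (2.14)–(2.15)] -/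
theorem IsInfinitesimalFieldThermalState.le_re_expect_localGammaTwo {κ U g g' β μ : ℝ}
    (hfloor : ∀ B : ℝ, 0 < B → ∀ ε : ℝ, 0 < ε → ∃ k₁ : ℕ, ∀ k : ℕ, k₁ ≤ k → ∀ [NeZero (2 * k)],
      μ - ε ≤ (Fintype.card (FermionTorus (d + 1) (2 * k)) : ℝ)⁻¹ *
        (gibbsState β (hamiltonianC κ U g g' (fun (_ _ : FermionTorus (d + 1) (2 * k)) => (0 : ℝ)) B)
          orderParameter).re)
    {ω : InfVolFermionState (d + 1)} (hω : IsInfinitesimalFieldThermalState κ U g g' β ω) (x : Site (d + 1)) :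
    μ ≤ (ω.expect {x} (localGammaTwo x)).re := by
  obtain ⟨B, ωB, hB, -, hS, hlim⟩ := hω
  exact ge_of_tendsto ((Complex.continuous_re.tendsto _).comp (hlim {x} (localGammaTwo x)))
    (Eventually.of_forall fun n => (hS n).le_re_expect_localGammaTwo (hfloor (B n) (hB n)) x)

/-- **Box form, sourced thermal limits**: `μ·|Λ| ≤ Re ω(O^{(Λ)})` on every finite region.
[cite: KomaTasaki1993, (2.11)] [cite: Koma2022, (2.15)] -/
theorem IsSourcedThermalLimit.boxOrder_ge {κ U g g' β B μ : ℝ}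
    (hfloor : ∀ ε : ℝ, 0 < ε → ∃ k₁ : ℕ, ∀ k : ℕ, k₁ ≤ k → ∀ [NeZero (2 * k)],
      μ - ε ≤ (Fintype.card (FermionTorus (d + 1) (2 * k)) : ℝ)⁻¹ *
        (gibbsState β (hamiltonianC κ U g g' (fun (_ _ : FermionTorus (d + 1) (2 * k)) => (0 : ℝ)) B)
          orderParameter).re)
    {ω : InfVolFermionState (d + 1)} (hω : IsSourcedThermalLimit κ U g g' β B ω) (Λ : Finset (Site (d + 1))) :
    μ * Λ.card ≤ (ω.expect Λ (orderParameter : FermionOp Λ)).re :=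
  boxOrder_ge_of_forall_site (fun x => hω.le_re_expect_localGammaTwo hfloor x) Λ

/-- **Box form, infinitesimal-field thermal states**: `μ·|Λ| ≤ Re ω(O^{(Λ)})` on every finite region.
[cite: KomaTasaki1993, (2.11)] [cite: Koma2022, (2.15)] -/
theorem IsInfinitesimalFieldThermalState.boxOrder_ge {κ U g g' β μ : ℝ}
    (hfloor : ∀ B : ℝ, 0 < B → ∀ ε : ℝ, 0 < ε → ∃ k₁ : ℕ, ∀ k : ℕ, k₁ ≤ k → ∀ [NeZero (2 * k)],
      μ - ε ≤ (Fintype.card (FermionTorus (d + 1) (2 * k)) : ℝ)⁻¹ *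
        (gibbsState β (hamiltonianC κ U g g' (fun (_ _ : FermionTorus (d + 1) (2 * k)) => (0 : ℝ)) B)
          orderParameter).re)
    {ω : InfVolFermionState (d + 1)} (hω : IsInfinitesimalFieldThermalState κ U g g' β ω)
    (Λ : Finset (Site (d + 1))) :
    μ * Λ.card ≤ (ω.expect Λ (orderParameter : FermionOp Λ)).re :=
  boxOrder_ge_of_forall_site (fun x => hω.le_re_expect_localGammaTwo hfloor x) Λ

/-! ### §4. Koma's model: spontaneous superconducting order at positive temperature in infinite volume -/

/-- **SPONTANEOUS SUPERCONDUCTING ORDER AT POSITIVE TEMPERATURE, INFINITE VOLUME.**  For `D = d+1 ≥ 3`, `g > 0`,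
`|κ| ≤ g/1000`, `0 ≤ g' ≤ g/2000`, `U + 2gD ≤ 0` there is `β₀ > 0` such that for every `β ≥ β₀` EVERY
infinitesimal-field thermal state `ω` at `β` (volume limit under a field `B_n > 0` of the translation-averaged Gibbs
states of `H(κ,U;g,g';0;B_n)`, then `B_n ↘ 0`) satisfies **`(3/100)·|Λ| ≤ Re ω(O^{(Λ)})` for EVERY finite region
`Λ ⊂ ℤ^D`**, `O^{(Λ)} = Σ_{x∈Λ}Γ²_x` — Koma's thermal long-range order (Theorem 2.1) ⟹ KT93's spontaneous order
parameter `m_s(β) ≥ √2σ > 3/100`, in state form. [cite: Koma2022, Theorem 2.1, (2.14)–(2.15)]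
[cite: KomaTasaki1993, (2.11), Theorem 2.1, Corollary 2.2 with Remark after Theorem 6.1] -/
theorem IsInfinitesimalFieldThermalState.boxOrder_ge_coulomb (hd : 2 ≤ d) {κ U g g' : ℝ} (hg : 0 < g)
    (hκg : |κ| ≤ g / 1000) (hg'0 : 0 ≤ g') (hg'g : g' ≤ g / 2000) (hU : U + 2 * g * (d + 1) ≤ 0) :
    ∃ β₀ : ℝ, 0 < β₀ ∧ ∀ β : ℝ, β₀ ≤ β → ∀ ω : InfVolFermionState (d + 1),
      IsInfinitesimalFieldThermalState κ U g g' β ω →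
        ∀ Λ : Finset (Site (d + 1)), (3 / 100 : ℝ) * Λ.card ≤ (ω.expect Λ (orderParameter : FermionOp Λ)).re := by
  obtain ⟨β₀, k₀, hβ₀, h⟩ := superconductingOrder_coulomb_abs hd hg hκg hg'0 hg'g hU
  refine ⟨β₀, hβ₀, fun β hβ ω hω Λ => hω.boxOrder_ge (fun B hB ε hε => ?_) Λ⟩
  obtain ⟨k₁, hk₁⟩ := thermal_orderParameter_ge_of_lroSq_sqrtTwo (d := d) (lt_of_lt_of_le hβ₀ hβ)
    (by norm_num : (0 : ℝ) ≤ 1 / 2000) (fun k hk _ => h β hβ k hk) hB hε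
  refine ⟨k₁, fun k hk _ => ?_⟩
  have h1 := hk₁ k hk
  have h2 := three_div_hundred_lt_sqrt
  linarith

/-- The same for every sourced thermal limit at any fixed field `B > 0` (before `B ↘ 0`), site by site:
`3/100 ≤ Re ω(Γ²_x)`. [cite: Koma2022, Theorem 2.1, (2.10)] [cite: KomaTasaki1993, (2.11), Theorem 2.1] -/
theorem IsSourcedThermalLimit.le_re_expect_localGammaTwo_coulomb (hd : 2 ≤ d) {κ U g g' : ℝ} (hg : 0 < g)
    (hκg : |κ| ≤ g / 1000) (hg'0 : 0 ≤ g') (hg'g : g' ≤ g / 2000) (hU : U + 2 * g * (d + 1) ≤ 0) :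
    ∃ β₀ : ℝ, 0 < β₀ ∧ ∀ β : ℝ, β₀ ≤ β → ∀ B : ℝ, 0 < B → ∀ ω : InfVolFermionState (d + 1),
      IsSourcedThermalLimit κ U g g' β B ω → ∀ x : Site (d + 1), (3 / 100 : ℝ) ≤ (ω.expect {x} (localGammaTwo x)).re := by
  obtain ⟨β₀, k₀, hβ₀, h⟩ := superconductingOrder_coulomb_abs hd hg hκg hg'0 hg'g hU
  refine ⟨β₀, hβ₀, fun β hβ B hB ω hω x => hω.le_re_expect_localGammaTwo (fun ε hε => ?_) x⟩
  obtain ⟨k₁, hk₁⟩ := thermal_orderParameter_ge_of_lroSq_sqrtTwo (d := d) (lt_of_lt_of_le hβ₀ hβ)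
    (by norm_num : (0 : ℝ) ≤ 1 / 2000) (fun k hk _ => h β hβ k hk) hB hε
  refine ⟨k₁, fun k hk _ => ?_⟩
  have h1 := hk₁ k hk
  have h2 := three_div_hundred_lt_sqrt
  linarith

/-! ### Non-vacuity: the limit states exist -/

/-- **Sourced thermal limits exist** at every `(β, B)`: realise the Gibbs state of `H_C(B)` on each even torus by a
probability mixture of unit vectors and extract a weak-⋆ convergent subsequence of the translation-averaged states
(`InfVolFermionState.exists_isTorusLimitOfMixture_subseq`). [cite: BratteliRobinsonI1987, Thm. 2.3.15 and §4.3.1] -/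
theorem exists_isSourcedThermalLimit (κ U g g' β B : ℝ) :
    ∃ ω : InfVolFermionState (d + 1), IsSourcedThermalLimit κ U g g' β B ω := by
  classical
  have hmix : ∀ L : ℕ, ∃ (m : ℕ) (p : Fin m → ℝ) (ψ : Fin m → Fock (Orb (FermionTorus (d + 1) L))),
      (∀ i, 0 ≤ p i) ∧ ∀ [NeZero L], ∑ i, p i = 1 ∧ (∀ i, star (ψ i) ⬝ᵥ ψ i = 1) ∧
        ∀ O : Matrix (Idx d L) (Idx d L) ℂ,
          gibbsState β (hamiltonianC κ U g g' (fun (_ _ : FermionTorus (d + 1) L) => (0 : ℝ)) B) O =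
            ∑ i, (p i : ℂ) * expect O (ψ i) := by
    intro L
    by_cases hL : L = 0
    · exact ⟨0, fun i => i.elim0, fun i => i.elim0, fun i => i.elim0, absurd hL (NeZero.ne L)⟩
    · haveI : NeZero L := ⟨hL⟩
      obtain ⟨m, p, ψ, hp0, hp1, hψ, hO, -⟩ := exists_torusAvgGibbsExpectAt_eq_mixture L β
        (hamiltonianC_isHermitian κ U g g' (fun (_ _ : FermionTorus (d + 1) L) => (0 : ℝ)) B)
      exact ⟨m, p, ψ, hp0, ⟨hp1, hψ, hO⟩⟩
  choose m p ψ hp0 hrest using hmix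
  have hLs : Tendsto (fun j : ℕ => 2 * (j + 1)) atTop atTop :=
    Filter.tendsto_atTop_atTop.2 fun b => ⟨b, fun j hj => by omega⟩
  have hne : ∀ j : ℕ, NeZero (2 * (j + 1)) := fun j => ⟨by omega⟩
  obtain ⟨φ, hφ, ω, hω⟩ := InfVolFermionState.exists_isTorusLimitOfMixture_subseq p ψ hLs
    (fun j i => hp0 _ i) (fun j => (@hrest _ (hne j)).1) (fun j i => (@hrest _ (hne j)).2.1 i)
  refine ⟨ω, fun j => φ j + 1, m, p, ψ, (tendsto_add_atTop_nat 1).comp hφ.tendsto_atTop, hp0,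
    fun j => (@hrest _ (hne (φ j))).1, fun j i => (@hrest _ (hne (φ j))).2.1 i,
    fun j _ O => (@hrest _ (hne (φ j))).2.2 O, ?_⟩
  exact hω.congr (Eventually.of_forall fun j => rfl)

/-- **Infinitesimal-field thermal states exist** at every `β`: sourced thermal limits at `B_n = 1/(n+1)` and a
weak-⋆ convergent subsequence (`InfVolFermionState.exists_tendsto_expect_subseq`). [cite: BratteliRobinsonI1987, Thm. 2.3.15] -/
theorem exists_isInfinitesimalFieldThermalState (κ U g g' β : ℝ) :
    ∃ ω : InfVolFermionState (d + 1), IsInfinitesimalFieldThermalState κ U g g' β ω := by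
  choose ωB hωB using fun n : ℕ => exists_isSourcedThermalLimit (d := d) κ U g g' β (1 / ((n : ℝ) + 1))
  obtain ⟨φ, hφ, ω, hω⟩ := InfVolFermionState.exists_tendsto_expect_subseq ωB
  refine ⟨ω, fun n => 1 / ((φ n : ℝ) + 1), fun n => ωB (φ n), fun n => by positivity, ?_, fun n => hωB (φ n), hω⟩
  exact tendsto_one_div_add_atTop_nhds_zero_nat.comp hφ.tendsto_atTop

/-- **END TO END** (KT93 (2.11) for Koma's model, all limits explicit): for `D = d+1 ≥ 3`, `g > 0`, `|κ| ≤ g/1000`,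
`0 ≤ g' ≤ g/2000`, `U + 2gD ≤ 0`, `β ≥ β₀`: infinitesimal-field thermal states EXIST, and EVERY one of them has
`(3/100)·|Λ| ≤ Re ω(O^{(Λ)})` on every finite `Λ ⊂ ℤ^D`. [cite: Koma2022, Theorem 2.1, (2.14)–(2.15)]
[cite: KomaTasaki1993, (2.11), Theorem 2.1, Corollary 2.2 with Remark after Theorem 6.1] -/
theorem thermal_koma_2_15_coulomb (hd : 2 ≤ d) {κ U g g' : ℝ} (hg : 0 < g) (hκg : |κ| ≤ g / 1000)
    (hg'0 : 0 ≤ g') (hg'g : g' ≤ g / 2000) (hU : U + 2 * g * (d + 1) ≤ 0) :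
    ∃ β₀ : ℝ, 0 < β₀ ∧ ∀ β : ℝ, β₀ ≤ β →
      (∃ ω : InfVolFermionState (d + 1), IsInfinitesimalFieldThermalState κ U g g' β ω) ∧
      ∀ ω : InfVolFermionState (d + 1), IsInfinitesimalFieldThermalState κ U g g' β ω →
        ∀ Λ : Finset (Site (d + 1)), (3 / 100 : ℝ) * Λ.card ≤ (ω.expect Λ (orderParameter : FermionOp Λ)).re := by
  obtain ⟨β₀, hβ₀, h⟩ := IsInfinitesimalFieldThermalState.boxOrder_ge_coulomb hd hg hκg hg'0 hg'g hU
  exact ⟨β₀, hβ₀, fun β hβ => ⟨exists_isInfinitesimalFieldThermalState κ U g g' β, h β hβ⟩⟩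

end KomaPiFlux

end Literature.MathematicalPhysics.QuantumLattice
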